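import Literature.AlgebraicGeometry.Hyperkaehler.KummerTypeIntermediateJacobian
import HarnessLib

/-!
# Discriminant-1 Weil abelian fourfolds ARE (up to isogeny) third intermediate Jacobians of projective `Kumⁿ`-type varieties (O'Grady 2021 Thm. 1.5, Markman 2023 Prop. 1.7 / proof of Thm. 1.5) — NAMED FACT

Family `hodge`, layer `Literature/AlgebraicGeometry/HodgeTheory` (the `HodgeWeil*` records of the
cross-ladder literature-typing layer, seat littype-FH1-1, home `run/shared/lean/pub/hodge-nonav/`).
This is the CONVERSE ("completeness") half of the O'Grady–Markman correspondence between projective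
irreducible holomorphic symplectic varieties `Y` of generalized Kummer deformation type and polarized
abelian fourfolds of Weil type with trivial discriminant, `Y ↦ J³(Y)`: the tree's record
`Hyperkaehler.Markman2023_thirdCohomology_kummerType_discOneWeilFourfold`
(file `Hyperkaehler/KummerTypeIntermediateJacobian`) states, for every smooth projective `Kumⁿ`-type
`X`, the existence of such a fourfold `T` (`= J³(X)` in print) with `H¹(T) ≅ H³(X)` through an
algebraic correspondence; the present record states that EVERY discriminant-1 Weil fourfold arises
this way up to isogeny.  Binders are copied symbol for symbol from that record and from
`HodgeTheory.FloccariFu2026_hodgeClasses_algebraic_powers_discOneWeilFourfold`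
(file `HodgeTheory/WeilFourfoldsDiscOnePowers`), so that the two directions compose by `rfl`-free
term plumbing (`exists_kummerType_roundTrip` below).

## Sources (READ at this seat; page:line = materialised files)

* K. G. O'Grady, *Compact tori associated to hyperkähler manifolds of Kummer type*, Int. Math. Res.
  Not. IMRN 2021, no. 16, 12356–12419 = arXiv:1805.12075 [`OGrady2021KummerTori`; REFEREED],
  **Theorem 1.5** (arXiv text `paper:arxiv-1805.12075` p0003 L66–L74), verbatim: "Let `X` be a
  hyperkähler variety of Kummer type, of dimension `2n`, and let `L` be an ample line bundle on `X`.
  Then `(J³(X),Θ_L)` is of Weil type, with an inclusion `ℚ√(-2(n+1)q_X(L)) ⊂ End(J³(X),Θ_L)_ℚ` […].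
  By varying `(X,L)`, one gets a complete (up to isogeny) family of `4` dimensional abelian varieties
  of Weil type with associated field `ℚ[√(-2(n+1)q_X(L))]`, and trivial determinant."; §5.1 (p0026
  L40–L42), verbatim: "complete up to isogeny means that every polarized abelian variety of Weil type
  `(A,φ,Θ)` with the given field and determinant is isogenous to one of the varieties in the family
  (of course the isogeny matches the endomorphisms and the polarizations)"; standing assumption
  "dimension at least `4`" (§1.2, p0003), i.e. `n ≥ 2`; §1 (p0002 L30–L31): "as `(X,L)` varies in a
  complete family of polarized hyperkählers of Kummer type with fixed discrete invariants, the
  corresponding polarized intermediate Jacobians `J³(X)` sweep out a complete family of polarized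
  abelian fourfolds of Weil type with fixed discrete invariants. Notice that the number of moduli for
  both families is equal to `4`."
* E. Markman, *The monodromy of generalized Kummer varieties and algebraic cycles on their
  intermediate Jacobians*, J. Eur. Math. Soc. 25 (2023) 231–321 [`Markman2023GeneralizedKummers`;
  REFEREED; published text = arXiv:1805.11574v4, fetched from ems.press (CC-BY 4.0) as
  `paper:url-6b0c3c2decc8`, file `p00NN` = printed page `230+NN`], §1.4 p. 236 (p0006), verbatim:
  "The proof of Theorem 1.5 involves the construction of a coherent sheaf over every 4-dimensional
  compact complex torus in a 5-dimensional family of such tori, which contains a representative of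
  each isogeny class of abelian 4-folds of Weil type of discriminant 1."; **Proposition 1.7**
  (= Prop. 12.6 and Cor. 12.9; p. 238 = p0008), verbatim: "Let `h ∈ S⁺` satisfy `(h,w) = 0` and
  `(h,h) < 0`. Set `d := (w,w)(h,h)/4`. The restriction of the universal torus `𝒯` to the
  4-dimensional subspace `Ω_{{w,h}^⊥} ⊂ Ω_{w^⊥}` consisting of periods `ℓ` orthogonal to `h` is a
  complete family of polarized 4-dimensional abelian fourfolds of Weil type of discriminant 1 with
  complex multiplication by `ℚ[√-d]`.  All possible imaginary quadratic number fields arise, since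
  the lattice `S⁺` is unimodular." and "The complex torus `T_ℓ`, `ℓ ∈ Ω_{w^⊥}`, is isogenous to the
  third intermediate Jacobian of every marked `2n`-dimensional irreducible holomorphic symplectic
  manifold `Y` in `𝔐⁰_{w^⊥}` with period `ℓ`, by Lemma 12.15."; **proof of Theorem 1.5** (p. 311 =
  p0081), verbatim: "The two discrete invariants, `K` and the discriminant, of a polarized abelian
  fourfold of Weil type `(A,K,h)` determine a 4-dimensional connected period domain of all polarized
  abelian fourfolds of Weil type with these two invariants, up to an isogeny compatible with the
  subspaces of Hodge–Weil classes, by [48, Lemma 4, Sec. 6 and Sec. 7]. Every polarized abelian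
  fourfold of Weil type `(A,K,h)` with discriminant 1 and imaginary quadratic field `K := ℚ[√-d]` is
  thus isogenous to `T_ℓ` for some period `ℓ` in the period domain `Ω_{{w,h′}^⊥}` given in (12.6),
  for some integral classes `w ∈ S⁺` and `h′ ∈ w^⊥` of negative self-intersection such that
  `(h′,h′)(w,w)/4 = d`, by Corollary 12.9 and Lemma 12.11."; **Lemma 12.15** (p. 307 = p0077): "There
  exists a global isogeny between the family of third intermediate Jacobians of `p : 𝒴 → 𝔐⁰_{w^⊥}`
  and the family `Per^*𝒯` over `𝔐⁰_{w^⊥}`."; §12.6 (p0077): "the third intermediate Jacobian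
  `H^{1,2}(Y_t)/H³(Y_t,ℤ)` is an abelian fourfold whenever `Y_t` is projective"; **Theorem 1.10**
  (p. 241) with Voisin's reformulation (below): the identification `H₁(J³(Y),ℚ) ≅ H³(Y,ℚ)` is induced
  by an algebraic cycle `𝒵 ∈ CH²(J³(Y) × Y)_ℚ` for projective `Y` of Kummer type.
* C. Voisin, *Footnotes to papers of O'Grady and Markman*, Math. Z. 300 (2022) 3405–3416
  (arXiv:2106.06979) [`Voisin2022FootnotesOGradyMarkman`; REFEREED], proof of Thm. 4.1 (arXiv p0010
  L52–L59), verbatim: "An equivalent version of Theorem [4.2 = Markman's Thm. 1.10] says that there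
  exists a codimension [2] cycle `𝒵 ∈ CH²(J³(X)×X)_ℚ` such that the map `[𝒵]_* : H₁(J³(X),ℚ) → H³(X,ℚ)`
  is the natural identification `H₁(J³(X),ℚ) ≅ H³(X,ℚ)`."
* [48] = C. Schoen, *Addendum to: Hodge classes on self-products of a variety with an automorphism*,
  Compositio Math. 114 (1998) [`Schoen1998HodgeWeilAddendum`], Lemma 4, §6–§7 (the period domain of
  polarized Weil type with fixed `(K, det)`); [49] = van Geemen LNM 1594 [`vanGeemen1994HodgeAV`],
  Lemma 5.2 (3) (the discriminant).

## Rendering (tree carriers) and faithfulness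

* "polarized abelian fourfold of Weil type `(A, K = ℚ(√-d), h)` of discriminant `1`" ↦ EXACTLY the
  binders of `FloccariFu2026_hodgeClasses_algebraic_powers_discOneWeilFourfold` and of
  `Markman2023_weilClasses_algebraic_discOneWeilFourfold`: `0 < d`, `A : Motives.AbelianVariety ℂ`,
  `A.dim = 2 * 2`, `φ : A ⟶ A` with `φ ≫ φ = -(d • 𝟙 A)` (`√-d ∈ End A` — an order of `K` acts; a
  restriction of the family, never more than print), a projective embedding `e`, a rational class
  `a ≠ 0` on `ℙ^{e.n}` and `Motives.IsHyperbolicWeilType A φ 2 (d·e^*a + φ^*e^*a)` — for FOURFOLDS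
  "hyperbolic ⟺ Witt index `2` ⟺ `det H = (-1)² = 1` ⟺ discriminant `1`" (dictionary of
  `Motives/HyperbolicWeilType`, van Geemen Lemma 5.2 / 5.4; module docstring of
  `WeilFourfoldsDiscOnePowers`), and the `K`-symmetrised hyperplane classes exhaust the printed
  polarizations `h` up to `ℚ^×_{>0}`.
* "is isogenous to `J³(Y)` for a projective irreducible holomorphic symplectic `Y` of generalized
  Kummer deformation type" ↦ as in the sibling record (the tree has no intermediate-Jacobian carrier;
  `J³(Y)` enters through its first cohomology): there are `n ≥ 2`, a smooth projective `Y` of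
  `Kumⁿ`-type (`Motives.IsSmoothProjective (2 * n) Y`, `Hyperkaehler.IsOfGeneralizedKummerType n Y`)
  and a BIJECTIVE `ℂ`-linear `γ : H¹(A(ℂ); ℂ) → H³(Y(ℂ); ℂ)` induced by an algebraic correspondence
  on `Y × A` (`HodgeTheory.IsAlgebraicCorrespondence (2 * n) (2 * 2) Y A.X γ`, file
  `HodgeTheory/MotivatedClasses`: `γ = Γ^*` for `Γ` in the `ℂ`-span of cycle classes on `Y × A`).  In
  print `γ` is the composite of the push-forward along the isogeny `A → J³(Y)` (the graph of an
  isogeny is an algebraic cycle; its action on `H¹` is bijective) with Markman's cycle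
  `𝒵 ∈ CH²(J³(Y) × Y)_ℚ` realising `H₁(J³(Y),ℚ) ≅ H³(Y,ℚ)` (Thm. 1.10 in Voisin's form, composed with
  the algebraic Lefschetz isomorphism `H¹(J³Y) ≅ H⁷(J³Y) = H₁(J³Y)`) — a composite of algebraic
  correspondences is an algebraic correspondence (Fulton, *Intersection Theory*, 16.1.1), the same
  one-step packaging as in the sibling record ("Transport to the isogenous `T_ℓ` composes with the
  graph of an isogeny").  Print gives RATIONAL cycles; the tree's predicate (`ℂ`-span of algebraic
  classes) is weaker, so nothing beyond print is asserted.
* QUANTIFIER SHAPE.  We record `∃ n ≥ 2` (some projective `Kumⁿ`-type `Y`), which is what Markman's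
  proof of Thm. 1.5 (p. 311: "isogenous to `T_ℓ` … for some integral classes `w ∈ S⁺` and `h′`") with
  Lemma 12.15 gives verbatim.  O'Grady's Thm. 1.5 is stated for EACH dimension `2n ≥ 4` ("By varying
  `(X,L)`, one gets a complete (up to isogeny) family … with associated field `ℚ[√(-2(n+1)q_X(L))]`"),
  so print yields `Y` of `Kumⁿ`-type for every prescribed `n ≥ 2` as soon as a polarized `Kumⁿ`-type
  `(X, L)` with `-2(n+1)q_X(L) ∈ -d·(ℚ^×)²` exists (it does: `q_X(L) = 2(n+1)d·j²` is a value of the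
  BBF form on `U ⊂ U^{⊕3} ⊕ ⟨-2n-2⟩`, surjectivity of the period map and Huybrechts' projectivity
  criterion) — that existence input is NOT part of O'Grady's sentence, so the `∀ n`-form is not
  asserted here.  -- TODO(general form): `∀ n ≥ 2` once polarized `Kumⁿ`-type varieties of prescribed
  BBF degree are a tree theorem.
* NOT asserted: that the isogeny "matches the endomorphisms and the polarizations" (O'Grady §5.1) —
  the tree's `γ` is a bare cohomological correspondence; the moduli count "number of moduli … equal
  to `4`"; `KS(X,L) ~ J³(X)⁴`; anything about discriminant `≠ 1` (Markman §1.2 of the arXiv text: the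
  Kummer-type intermediate Jacobians "all have trivial discriminant", Lemma 12.11).

Consumers: the b2b `hweil` ladder rung "R5 — generalized-Kummer / hyper-Kähler relatives" (this is
the bridge by which ANY theorem about `H³` of projective `Kumⁿ`-type varieties — Floccari 2023/2026,
Floccari–Fu 2026 via `OG6` — becomes a theorem about ALL discriminant-1 Weil fourfolds; cf. the
module docstring of `WeilFourfoldsDiscOnePowers`); cell `hodge-kum4` lemma L2 (reverse direction);
the CROSS-LADDER typing layer's "recent-theorem harvest" for rung F-H1.

D-0026 accounting: ONE new named fact (a refereed theorem in print: IMRN 2021 Thm. 1.5 ∧ JEMS 2023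
Prop. 1.7 / proof of Thm. 1.5 / Lemma 12.15 / Thm. 1.10 ∧ Math. Z. 2022 §4), cited at the page; no
restatement of a tree fact (the sibling record is the converse implication); the round trip below is
PROVED.
-/

noncomputable section

open CategoryTheory

namespace Literature.AlgebraicGeometry.HodgeTheory

open Literature.AlgebraicTopology.SingularHomology
open Literature.AlgebraicGeometry.Hyperkaehler (IsOfGeneralizedKummerType
  Markman2023_thirdCohomology_kummerType_discOneWeilFourfold)

section HodgeTheory

/-- **O'Grady 2021 (IMRN, Thm. 1.5, "complete (up to isogeny) family") ∧ Markman 2023 (JEMS 25,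
Prop. 1.7 and proof of Thm. 1.5, p. 311, with Lemma 12.15 and Thm. 1.10 in Voisin's form) — every
polarized abelian fourfold of Weil type of discriminant `1`, for EVERY imaginary quadratic field
`K = ℚ(√-d)`, is isogenous to the third intermediate Jacobian `J³(Y)` of a PROJECTIVE irreducible
holomorphic symplectic variety `Y` of generalized Kummer deformation type.**  O'Grady: "By varying
`(X,L)`, one gets a complete (up to isogeny) family of `4` dimensional abelian varieties of Weil type
with associated field `ℚ[√(-2(n+1)q_X(L))]`, and trivial determinant", where "complete up to isogeny
means that every polarized abelian variety of Weil type `(A,φ,Θ)` with the given field and determinant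
is isogenous to one of the varieties in the family"; Markman: "Every polarized abelian fourfold of
Weil type `(A,K,h)` with discriminant 1 and imaginary quadratic field `K := ℚ[√-d]` is thus isogenous
to `T_ℓ` for some period `ℓ` in the period domain `Ω_{{w,h′}^⊥}`", "`T_ℓ` … is isogenous to the third
intermediate Jacobian of every marked `2n`-dimensional irreducible holomorphic symplectic manifold
`Y` in `𝔐⁰_{w^⊥}` with period `ℓ`, by Lemma 12.15", "All possible imaginary quadratic number fields
arise".  Rendering (module docstring): Weil binders = those of
`FloccariFu2026_hodgeClasses_algebraic_powers_discOneWeilFourfold` (`0 < d`, `A.dim = 2 * 2`,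
`φ ≫ φ = -(d • 𝟙 A)`, embedding `e`, rational `a ≠ 0`, `IsHyperbolicWeilType A φ 2 (d·e^*a + φ^*e^*a)`;
hyperbolic ⟺ discriminant `1` for fourfolds); conclusion = some `n ≥ 2`, a smooth projective `Y` of
`Kumⁿ`-type and a bijective `γ : H¹(A(ℂ); ℂ) → H³(Y(ℂ); ℂ)` induced by an algebraic correspondence
on `Y × A` (isogeny `A → J³(Y)` composed with Markman's cycle `𝒵`).  A THEOREM in print (REFEREED:
IMRN 2021, JEMS 2023, Math. Z. 2022); unproved in the tree.
-- TODO(general form): the `∀ n ≥ 2` form (O'Grady Thm. 1.5 is per dimension `2n`), see module docstring.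
[cite: OGrady2021KummerTori, Thm. 1.5 (arXiv:1805.12075 §1.2, p. 3) and §5.1 ("complete up to isogeny means …", p. 26)]
[cite: Markman2023GeneralizedKummers, Prop. 1.7 (p. 238), proof of Thm. 1.5 (p. 311), Lemma 12.15 (p. 307), Thm. 1.10 (p. 241); JEMS 25 (2023) printed numbering]
[cite: Voisin2022FootnotesOGradyMarkman, proof of Thm. 4.1 (§4, the cycle 𝒵 ∈ CH²(J³(X) × X))] -/
def OGradyMarkman_discOneWeilFourfold_isThirdJacobian_kummerType : Prop :=
  ∀ (d : ℕ), 0 < d → ∀ (A : Motives.AbelianVariety ℂ) (φ : A ⟶ A), A.dim = 2 * 2 →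
    φ ≫ φ = -(d • 𝟙 A) →
      ∀ (e : Motives.ProjectiveEmbedding A.X)
        (a : complexBetti (Motives.projectiveSpace e.n ℂ) 2), IsRationalClass a → a ≠ 0 →
        Motives.IsHyperbolicWeilType A φ 2
          ((d : ℂ) • complexBetti.map e.ι 2 a +
            complexBetti.map φ.hom.hom.hom 2 (complexBetti.map e.ι 2 a)) →
        ∃ (n : ℕ) (Y : Motives.SchemeOver ℂ) (γ : complexBetti A.X 1 →ₗ[ℂ] complexBetti Y 3),
          2 ≤ n ∧ Motives.IsSmoothProjective (2 * n) Y ∧ IsOfGeneralizedKummerType n Y ∧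
            Function.Bijective γ ∧ IsAlgebraicCorrespondence (2 * n) (2 * 2) Y A.X γ

namespace OGradyMarkman_discOneWeilFourfold_isThirdJacobian_kummerType

/-- **The round trip (kernel, modulo the two records).**  Every discriminant-1 Weil fourfold `A`
is matched with a smooth projective `Kumⁿ`-type `Y`, `n ≥ 2`, carrying `H¹(A) ≅ H³(Y)` through an
algebraic correspondence (this record), and `Y` in turn carries a discriminant-1 Weil fourfold `T`
(print: `J³(Y)`) with `H¹(T) ≅ H³(Y)` through an algebraic correspondence (the sibling record
`Markman2023_thirdCohomology_kummerType_discOneWeilFourfold`) — O'Grady's "the corresponding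
polarized intermediate Jacobians `J³(X)` sweep out a complete family", both containments.
[cite: OGrady2021KummerTori, §1 (p. 2, "sweep out a complete family") and Thm. 1.5]
[cite: Markman2023GeneralizedKummers, Prop. 1.7 (p. 238) and proof of Thm. 1.5 (p. 311)] -/
theorem exists_kummerType_roundTrip
    (h : OGradyMarkman_discOneWeilFourfold_isThirdJacobian_kummerType)
    (h' : Markman2023_thirdCohomology_kummerType_discOneWeilFourfold)
    {d : ℕ} (hd : 0 < d) (A : Motives.AbelianVariety ℂ) (φ : A ⟶ A) (hA : A.dim = 2 * 2)
    (hφ : φ ≫ φ = -(d • 𝟙 A)) (e : Motives.ProjectiveEmbedding A.X)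
    (a : complexBetti (Motives.projectiveSpace e.n ℂ) 2) (ha : IsRationalClass a) (ha0 : a ≠ 0)
    (hyp : Motives.IsHyperbolicWeilType A φ 2
      ((d : ℂ) • complexBetti.map e.ι 2 a +
        complexBetti.map φ.hom.hom.hom 2 (complexBetti.map e.ι 2 a))) :
    ∃ (n : ℕ) (Y : Motives.SchemeOver ℂ) (γ : complexBetti A.X 1 →ₗ[ℂ] complexBetti Y 3)
      (T : Motives.AbelianVariety ℂ) (γ' : complexBetti T.X 1 →ₗ[ℂ] complexBetti Y 3),
      2 ≤ n ∧ Motives.IsSmoothProjective (2 * n) Y ∧ IsOfGeneralizedKummerType n Y ∧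
        Function.Bijective γ ∧ IsAlgebraicCorrespondence (2 * n) (2 * 2) Y A.X γ ∧
        T.dim = 2 * 2 ∧ Function.Bijective γ' ∧ IsAlgebraicCorrespondence (2 * n) (2 * 2) Y T.X γ' := by
  obtain ⟨n, Y, γ, hn, hY, hK, hγ, hγalg⟩ := h d hd A φ hA hφ e a ha ha0 hyp
  obtain ⟨d', T, ψ, e', a', γ', -, hT, -, -, -, -, hγ', hγ'alg⟩ := h' n hn hY hK
  exact ⟨n, Y, γ, T, γ', hn, hY, hK, hγ, hγalg, hT, hγ', hγ'alg⟩

/-- The spelling with the dimension of `A` as `4` (for consumers quantifying over `A.dim = 4`).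
[cite: OGrady2021KummerTori, Thm. 1.5] -/
theorem of_dim_eq_four (h : OGradyMarkman_discOneWeilFourfold_isThirdJacobian_kummerType)
    {d : ℕ} (hd : 0 < d) (A : Motives.AbelianVariety ℂ) (φ : A ⟶ A) (hA : A.dim = 4)
    (hφ : φ ≫ φ = -(d • 𝟙 A)) (e : Motives.ProjectiveEmbedding A.X)
    (a : complexBetti (Motives.projectiveSpace e.n ℂ) 2) (ha : IsRationalClass a) (ha0 : a ≠ 0)
    (hyp : Motives.IsHyperbolicWeilType A φ 2
      ((d : ℂ) • complexBetti.map e.ι 2 a +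
        complexBetti.map φ.hom.hom.hom 2 (complexBetti.map e.ι 2 a))) :
    ∃ (n : ℕ) (Y : Motives.SchemeOver ℂ) (γ : complexBetti A.X 1 →ₗ[ℂ] complexBetti Y 3),
      2 ≤ n ∧ Motives.IsSmoothProjective (2 * n) Y ∧ IsOfGeneralizedKummerType n Y ∧
        Function.Bijective γ ∧ IsAlgebraicCorrespondence (2 * n) (2 * 2) Y A.X γ :=
  h d hd A φ (by simpa using hA) hφ e a ha ha0 hyp

end OGradyMarkman_discOneWeilFourfold_isThirdJacobian_kummerType

end HodgeTheory

end Literature.AlgebraicGeometry.HodgeTheory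

end
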